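import Summits.Ventures.HSemireg.WedgeHankelRecurrenceGaussChebyshevNodeSums

/-!
# Venture HSemireg — **PRODUCTS OF GAUSS NODES (`det J_t`) IN CLOSED FORM**: `∏_k x_k = (−1)^{t+1} q_{t+1}(0)` for any `q_{t+1} = ∏ (X − x_k)`; hence **Laguerre `∏ x_k = (α+1)(α+2)⋯(α+t+1)`**
# (`L̂_n(0) = (−1)^n (α+1)_n`), **Hermite `∏ x_k = (−1)^{m+1} (2m+1)‼`** for `He_{2m+2}` and `0` for `He_{2m+1}` (Mathlib `coeff_hermite_explicit`), **Legendre `∏ x_k = (−1)^{m+1} ∏_{k≤m}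
# (2k+1)²∕(4(2k+1)²−1)`** for `P̂_{2m+2}` and `0` for `P̂_{2m+1}` (N437)

HONEST FRAMING. Part of the Lean index of the computation cell `pub-hsemireg` (seat p10 gen 47, Sunday typer «UNIFORM-IN-n»).  Finite products and polynomial evaluation only; no variety, no
cohomology theory, no sheaf, no Ext group and no semiregularity map is constructed here; nothing here says that HC / HC_CM / HC_AV holds; no Literature fact (unproved `Prop`) is declared or used.
Custodian versions as in `WedgeHankelSiegelIdeal` (1/3).
SOURCES (cited).  G. Szegő, *Orthogonal Polynomials*, (5.1.7) (`L_n^{(α)}(0) = binom(n+α, n)`), (5.5.5) (`H_{2m}(0)`), (4.7.4) (`P_{2m}(0)`); G. H. Golub, J. H. Welsch, Math. Comp. 23 (1969) 221–230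
(`det J` = product of the nodes); T. S. Chihara, *An Introduction to Orthogonal Polynomials* (1978), Ch. I §4.  The closed products are COROLLARIES typed here.
PROOF TYPED HERE.  Evaluation of `∏ (X − x_k)` at `0` (`Finset.prod_neg`); two-step induction for `L̂_n(0)`; Mathlib `coeff_hermite_explicit`, `coeff_hermite_of_odd_add`, `eval₂_at_zero`; N437
`legendre_eval_zero`.
DEDUP DISCLOSURE (`rg -n -i 'zeros_prod|prod_zeros_eq_eval|laguerre_eval_zero' Summits/Ventures/HSemireg`, 2026-09-04): §1063 `det_jacobi_eq_prod_zeros` (determinant form, no closed values);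
N441 (Chebyshev products); 0 hits for the 8 names below.

WHAT IS IN THE TREE.  §1063 `det_jacobi_eq_prod_zeros`; N437 `legendre_eval_zero`; N441 `chebyshev_nodes_prod`; §11xx `laguerre_zeros`, `hermite_zeros` (existence of the increasing zeros).
THIS FILE (namespace `Summit.Ventures.HSemireg.Wedge.HankelOuter` continued; CHAINED on N441; 0 definitions):
* §1207 **`prod_zeros_eq_eval_zero`**, **`laguerre_eval_zero`**, **`laguerre_zeros_prod`**, `hermite_zeros_prod_odd`, **`hermite_zeros_prod_even`**, `legendre_zeros_prod_odd`,
  `legendre_zeros_prod_even`.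
CAVEATS.  The zero vectors enter as any `x` with the product representation (they exist and are increasing by §11xx).  Nothing Ext-side.  New names only.
-/

open Module Polynomial
open scoped Matrix Polynomial Nat

namespace Summit.Ventures.HSemireg.Wedge.HankelOuter

/-! ## §1207. Products of the zeros -/

/-- **`∏_k x_k = (−1)^{t+1} p(0)`** whenever `p = ∏_{k ≤ t} (X − x_k)` (any commutative ring). [Golub–Welsch 1969 (`det J`); this file, §1207] -/
theorem prod_zeros_eq_eval_zero {R : Type*} [CommRing R] {p : R[X]} {t : ℕ} {x : Fin (t + 1) → R} (hxq : p = ∏ k, (Polynomial.X - C (x k))) :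
    ∏ k, x k = (-1) ^ (t + 1) * p.eval 0 := by
  have h := congrArg (Polynomial.eval 0) hxq
  rw [eval_prod] at h
  simp only [eval_sub, eval_X, eval_C, zero_sub] at h
  rw [Finset.prod_neg, Finset.card_univ, Fintype.card_fin] at h
  have hone : ((-1 : R) ^ (t + 1)) * (-1) ^ (t + 1) = 1 := by rw [← pow_add, Even.neg_one_pow ⟨t + 1, rfl⟩]
  calc ∏ k, x k = ((-1 : R) ^ (t + 1) * (-1) ^ (t + 1)) * ∏ k, x k := by rw [hone, one_mul]
    _ = (-1) ^ (t + 1) * p.eval 0 := by rw [mul_assoc, ← h]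

/-- **`L̂_n(0) = (−1)^n (α+1)(α+2)⋯(α+n)`** for the monic Laguerre recurrence `a_n = 2n+1+α`, `b_n = n(n+α)`. [Szegő (5.1.7); this file, §1207] -/
theorem laguerre_eval_zero {L : ℕ → ℝ[X]} {a b : ℕ → ℝ} {α : ℝ} (hL0 : L 0 = 1) (hL1 : L 1 = Polynomial.X - C (a 0))
    (hLrec : ∀ n, L (n + 2) = (Polynomial.X - C (a (n + 1))) * L (n + 1) - C (b (n + 1)) * L n) (ha : ∀ n, a n = 2 * n + 1 + α)
    (hb : ∀ n, b (n + 1) = ((n : ℝ) + 1) * ((n : ℝ) + 1 + α)) (n : ℕ) :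
    (L n).eval 0 = (-1) ^ n * ∏ j ∈ Finset.range n, ((j : ℝ) + 1 + α) := by
  have key : ∀ n : ℕ, (L n).eval 0 = (-1) ^ n * ∏ j ∈ Finset.range n, ((j : ℝ) + 1 + α) ∧
      (L (n + 1)).eval 0 = (-1) ^ (n + 1) * ∏ j ∈ Finset.range (n + 1), ((j : ℝ) + 1 + α) := by
    intro n
    induction n with
    | zero =>
      refine ⟨by rw [hL0, eval_one, pow_zero, Finset.prod_range_zero, mul_one], ?_⟩
      rw [Nat.zero_add, hL1, ha, eval_sub, eval_X, eval_C, Finset.prod_range_one]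
      push_cast
      ring
    | succ n ih =>
      obtain ⟨h0, h1⟩ := ih
      refine ⟨h1, ?_⟩
      rw [show n + 1 + 1 = n + 2 from rfl, hLrec, eval_sub, eval_mul, eval_sub, eval_X, eval_C, eval_mul, eval_C, h0, h1, ha, hb]
      simp only [Finset.prod_range_succ]
      push_cast
      ring
  exact (key n).1

/-- **PRODUCT OF THE LAGUERRE ZEROS: `∏_k x_k = (α+1)(α+2)⋯(α+t+1)`** (`= (t+1)!` for `α = 0`). [Szegő (5.1.7); this file, §1207] -/
theorem laguerre_zeros_prod {L : ℕ → ℝ[X]} {a b : ℕ → ℝ} {α : ℝ} (hL0 : L 0 = 1) (hL1 : L 1 = Polynomial.X - C (a 0))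
    (hLrec : ∀ n, L (n + 2) = (Polynomial.X - C (a (n + 1))) * L (n + 1) - C (b (n + 1)) * L n) (ha : ∀ n, a n = 2 * n + 1 + α)
    (hb : ∀ n, b (n + 1) = ((n : ℝ) + 1) * ((n : ℝ) + 1 + α)) {t : ℕ} {x : Fin (t + 1) → ℝ} (hxq : L (t + 1) = ∏ k, (Polynomial.X - C (x k))) :
    ∏ k, x k = ∏ j ∈ Finset.range (t + 1), ((j : ℝ) + 1 + α) := by
  rw [prod_zeros_eq_eval_zero hxq, laguerre_eval_zero hL0 hL1 hLrec ha hb (t + 1), ← mul_assoc, ← pow_add, Even.neg_one_pow ⟨t + 1, rfl⟩, one_mul]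

/-- **Odd Hermite: `∏_k x_k = 0`** for the zeros of `He_{2m+1}` (`0` is a zero). [Szegő (5.5.5); Mathlib `coeff_hermite_of_odd_add`; this file, §1207] -/
theorem hermite_zeros_prod_odd (m : ℕ) {x : Fin (2 * m + 1) → ℝ} (hx : (Polynomial.hermite (2 * m + 1)).map (Int.castRingHom ℝ) = ∏ k, (Polynomial.X - C (x k))) :
    ∏ k, x k = 0 := by
  rw [prod_zeros_eq_eval_zero hx, eval_map, eval₂_at_zero, Polynomial.coeff_hermite_of_odd_add (by rw [Nat.add_zero]; exact ⟨m, rfl⟩), map_zero, mul_zero]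

/-- **Even Hermite: `∏_k x_k = (−1)^{m+1} (2m+1)‼`** for the zeros of `He_{2m+2}`. [Szegő (5.5.5); Mathlib `coeff_hermite_explicit`; this file, §1207] -/
theorem hermite_zeros_prod_even (m : ℕ) {x : Fin (2 * m + 2) → ℝ} (hx : (Polynomial.hermite (2 * m + 2)).map (Int.castRingHom ℝ) = ∏ k, (Polynomial.X - C (x k))) :
    ∏ k, x k = (-1) ^ (m + 1) * ((2 * m + 1)‼ : ℝ) := by
  have hc : (Polynomial.hermite (2 * m + 2)).coeff 0 = (-1) ^ (m + 1) * (2 * m + 1)‼ := by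
    have h := Polynomial.coeff_hermite_explicit (m + 1) 0
    rw [Nat.add_zero, Nat.choose_zero_right, Nat.cast_one, mul_one, show 2 * (m + 1) - 1 = 2 * m + 1 by omega] at h
    rw [show 2 * m + 2 = 2 * (m + 1) by ring]
    exact h
  rw [prod_zeros_eq_eval_zero hx, eval_map, eval₂_at_zero, hc, map_mul, map_pow, map_neg, map_one, map_natCast,
    Even.neg_one_pow (show Even (2 * m + 1 + 1) from ⟨m + 1, by ring⟩), one_mul]

/-- **Odd Legendre: `∏_k x_k = 0`** for the zeros of `P̂_{2m+1}`. [Szegő (4.7.4); this file, §1207] -/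
theorem legendre_zeros_prod_odd {q : ℕ → ℝ[X]} {a b : ℕ → ℝ} (hq0 : q 0 = 1) (hq1 : q 1 = Polynomial.X - C (a 0))
    (hrec : ∀ n, q (n + 2) = (Polynomial.X - C (a (n + 1))) * q (n + 1) - C (b (n + 1)) * q n) (ha : ∀ n, a n = 0)
    (hb : ∀ n, b (n + 1) = ((n : ℝ) + 1) ^ 2 / (4 * ((n : ℝ) + 1) ^ 2 - 1)) (m : ℕ) {x : Fin (2 * m + 1) → ℝ} (hxq : q (2 * m + 1) = ∏ k, (Polynomial.X - C (x k))) :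
    ∏ k, x k = 0 := by
  rw [prod_zeros_eq_eval_zero hxq, (legendre_eval_zero hq0 hq1 hrec ha hb m).1, mul_zero]

/-- **Even Legendre: `∏_k x_k = (−1)^{m+1} ∏_{k≤m} (2k+1)²∕(4(2k+1)²−1)`** for the zeros of `P̂_{2m+2}`. [Szegő (4.7.4); this file, §1207] -/
theorem legendre_zeros_prod_even {q : ℕ → ℝ[X]} {a b : ℕ → ℝ} (hq0 : q 0 = 1) (hq1 : q 1 = Polynomial.X - C (a 0))
    (hrec : ∀ n, q (n + 2) = (Polynomial.X - C (a (n + 1))) * q (n + 1) - C (b (n + 1)) * q n) (ha : ∀ n, a n = 0)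
    (hb : ∀ n, b (n + 1) = ((n : ℝ) + 1) ^ 2 / (4 * ((n : ℝ) + 1) ^ 2 - 1)) (m : ℕ) {x : Fin (2 * m + 2) → ℝ} (hxq : q (2 * m + 2) = ∏ k, (Polynomial.X - C (x k))) :
    ∏ k, x k = (-1) ^ (m + 1) * ∏ k ∈ Finset.range (m + 1), ((2 * (k : ℝ) + 1) ^ 2 / (4 * (2 * (k : ℝ) + 1) ^ 2 - 1)) := by
  rw [prod_zeros_eq_eval_zero hxq, show 2 * m + 2 = 2 * (m + 1) by ring, (legendre_eval_zero hq0 hq1 hrec ha hb (m + 1)).2, ← mul_assoc, pow_mul, neg_one_sq, one_pow, one_mul]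

end Summit.Ventures.HSemireg.Wedge.HankelOuter
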